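import Summits.ResolutionOfSingularities.ResolutionOfSingularities.Theorems.EquisingularLiftEquisingularLiftNatTowerRoundBDefs
import HarnessLib

/-!
# T23-A′ «B-TRACE» — DOWNSTAIRS DEFS (text owner res-L1-w45b-lead-2 g5; desk RULING R14 (1) / R15 (i)(ii) «FILE THE DEFS NOW», 2026-08-28T06:22:49Z):
# `RoundTransportOKPrime` / `TowerRoundBPrime` / `ReachTowerBPrime` / `ReachNoseTowerBPrime` + monotonicity `reachTowerBPrime_of_reachTowerB` /
# `reachNoseTowerBPrime_of_reachNoseTowerB` — the vocabulary of the T23-A′ registration (drafts CHILD v34 2d2bfb36b96323c9 / PARENT v36 3911b77713230aa5 of record)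

OURS · L1 W4.5(b) · EL♮(3) stmt-ResolutionOfSingularities-20148 · counted 0 · AI-written planning vocabulary, weaker than expert review; nothing of [Hironaka2017]
asserted; NOT a statement of the manuscript. Definitions + pure-logic monotonicity only (no `sorry`, no instance, no notation; standard axioms).
`--kind definition --supports stmt-ResolutionOfSingularities-20148 --as helper`. Registration mode (desk R15 (iii)): ENGINE-GREEN SWAP — the engine owner
res-L1-w45b-stub-4 proves the two B′ rungs (`TARGET-DEFTOWERBPRIME-THREE.sig.txt` f09847aa6e554416 / `TARGET-DEFNOSETOWERBPRIME-THREE.sig.txt` 5759659e70196094,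
HOME `L/res-L1-w45b-lead-2/t23aprime/`) as helper theorems naming THIS file's `ReachTowerBPrime` / `ReachNoseTowerBPrime`; then ONE registration derives them.

DESIGN (minimal churn, exactly as T23-A was cut from ₆): every definition of …NatTowerRoundBDefs (p601799) is REUSED; the ONLY change is the member-transport
rule of the ROUND step. `RoundTransportOK υ₂ Z Hst F F' := (F = Hst ∨ Disjoint Z F) ∧ F' = closure υ₂⁻¹(F ∖ Z)` (tier 1: a non-host member met by the centre is
lost) becomes `RoundTransportOKPrime υ₂ Z hZ Hst F F'` with a THIRD admission disjunct — the member is CROSSED TRANSVERSALLY by the centre, stated STALKWISE on the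
traces exactly as the upstairs bricks consume it ((A′-1) v2 p608670 `hasSNCWith_member_centre_of_trace_transversal`, (A′-3) v2 SIG 767f3543c2b2e4ae, binders `hT1`/`hT2`
token-identical): `∃ hF : IsClosed F, (T1) ∀ g ∈ Z ∩ F, 𝓘⟨Z⟩_g ⊔ 𝓘⟨F⟩_g = 𝔪_{G,g} ∧ (T2) ∀ g ∈ Z ∩ F, 𝓘⟨Z⟩_g ≠ 𝔪_{G,g}` (the set-theoretic rule «Z ∩ F finite
with closed points, 𝓘⟨Z⟩ ⊔ 𝓘⟨F⟩ = 𝓘⟨Z ∩ F⟩, Z irreducible and not a point» implies it: bridge p609104 `trace_rule_to_stalkwise`); the transported member is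
`closure υ₂⁻¹(F ∖ Z)` in all three cases. Point steps (`TowerPtRegB` / `TowerPtRamB`, `PtTransportOK`) are UNCHANGED (engine word stub-4 g10 2026-08-28T06:06:45Z: the
B engine never blows up an O-point through a model-carrying member off the section — (L1″) struck). `TowerRoundBPrime` = `TowerRoundB` verbatim with
`RoundTransportOKPrime` (one extra argument `hZ` in the list clause); `ReachTowerBPrime` / `ReachNoseTowerBPrime` = the ₆/₇-prefixed closures over (`TowerPtRegB`,
`TowerPtRamB`, `TowerRoundBPrime`). Monotonicity (pure logic, proved): a B-chain is a B′-chain (`RoundTransportOK → RoundTransportOKPrime`, so closure under the B′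
round step implies closure under the B round step) ⇒ `ReachTowerB → ReachTowerBPrime`, `ReachNoseTowerB → ReachNoseTowerBPrime` — the registered B-residues
NARROW by one more ¬hypothesis each and the B rungs p605796 / p605774 are the B-reachable sub-case of the B′ rungs.
-/

set_option linter.dupNamespace false

noncomputable section

open CategoryTheory CategoryTheory.Limits AlgebraicGeometry TopologicalSpace Topology IsLocalRing
open Literature.AlgebraicGeometry.Resolution
open AlgebraicGeometry.Scheme.IdealSheafData

namespace Summit.ResolutionOfSingularities.ResolutionOfSingularities.Cruxes.EquisingularLiftNat.Sections

/-- **Admissible transport of a retained member `F` at a ROUND with centre `Z` hosted by `Hst` — T23-A′ form.** The member survives as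
`F' = closure υ₂⁻¹(F ∖ Z)` when (i) it IS the host, or (ii) the centre misses it (B-AWAY), or (iii) NEW: the centre CROSSES it transversally at points where `Z` is
not isolated — stalkwise on the traces: (T1) `𝓘⟨Z⟩_g ⊔ 𝓘⟨F⟩_g = 𝔪_{G,g}` and (T2) `𝓘⟨Z⟩_g ≠ 𝔪_{G,g}` for every `g ∈ Z ∩ F` (the hypotheses of (A′-1) v2 p608670 /
(A′-3) v2; the v1 set-theoretic wording was refuted at isolated crossing points by stub-4's witness `C = (s,t)`, `𝓕 = (s − ϖ²)`). [OURS · T23-A′ Defs] -/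
def RoundTransportOKPrime {G G' : Scheme.{0}} (υ₂ : G' ⟶ G) (Z : Set G) (hZ : IsClosed Z) (Hst F : Set G) (F' : Set G') : Prop :=
  (F = Hst ∨ Disjoint Z F ∨
      ∃ hF : IsClosed F,
        (∀ g ∈ Z ∩ F, stalkIdeal (vanishingIdeal (⟨Z, hZ⟩ : Closeds G)) g ⊔ stalkIdeal (vanishingIdeal (⟨F, hF⟩ : Closeds G)) g =
            maximalIdeal (G.presheaf.stalk g)) ∧
          ∀ g ∈ Z ∩ F, stalkIdeal (vanishingIdeal (⟨Z, hZ⟩ : Closeds G)) g ≠ maximalIdeal (G.presheaf.stalk g)) ∧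
    F' = closure (υ₂ ⁻¹' (F \ Z))

/-- Tier-1 transports are T23-A′ transports. [OURS · pure logic] -/
theorem roundTransportOKPrime_of_roundTransportOK {G G' : Scheme.{0}} {υ₂ : G' ⟶ G} {Z : Set G} (hZ : IsClosed Z) {Hst F : Set G} {F' : Set G'}
    (h : RoundTransportOK υ₂ Z Hst F F') : RoundTransportOKPrime υ₂ Z hZ Hst F F' :=
  ⟨h.1.elim Or.inl (fun hd => Or.inr (Or.inl hd)), h.2⟩

/-- **TOWER-B′ / (round)** — `TowerRoundB` VERBATIM (both hosting disjuncts, the cone-shadow clauses, `E'`), with ONE change: the retained list after the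
round consists of `RoundTransportOKPrime`-admissible transports of members of `E :: Es` — i.e. a member CROSSED by the centre transversally (stalkwise (T1) ∧ (T2)
on the traces) is now KEPT as `closure υ₂⁻¹(F ∖ Z)` instead of being lost (T23-A′ «B-TRACE»; upstairs: (A′-1) p608670 + (A′-2) p606871 + (A′-3) + (A′-4) ≡ tree).
[OURS · Defs of the T23-A′ registration] -/
def TowerRoundBPrime (F₉ F₁₀ : Scheme.{0}) (υ' : F₁₀ ⟶ F₉) (Z₉ : Set F₉) (hZ₉ : IsClosed Z₉)
    (R : ∀ G : Scheme.{0}, (G ⟶ F₁₀) → Set G → Set G → List (Set G) → Set G → Prop) : Prop :=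
  ∀ (G G' : Scheme.{0}) (γ : G ⟶ F₁₀) (T E : Set G) (Es : List (Set G)) (K : Set G) (hE : IsClosed E) (Z : Set G) (hZ : IsClosed Z)
      (Hst : Set G) (υ₂ : G' ⟶ G) (K' : Set G') (E' : Set G') (Es' : List (Set G')),
    R G γ T E Es K →
    Z ⊆ T → Z.Nonempty →
    TowerFull F₉ F₁₀ υ' Z₉ hZ₉ G γ Z hZ →
    ((Hst = E ∧ Z ⊆ E ∧
        ((DirStepSec F₉ F₁₀ υ' Z₉ hZ₉ G γ Z hZ ∧
            ((RationalCarrier (redSub F₉ Z₉ hZ₉) ∧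
                (∀ x : redSub G Z hZ, IsRegularLocalRing (G.presheaf.stalk (redSubι G Z hZ x))) ∧
                (∀ (i : redSub G Z hZ ⟶ redSub G E hE), i ≫ redSubι G E hE = redSubι G Z hZ →
                  ∀ x : redSub G Z hZ, IsRegularLocalRing ((redSub G E hE).presheaf.stalk (i x))) ∧
                DirStepUnobs G E hE Z hZ) ∨
              ConeWitness G E hE K Z hZ)) ∨
          (IsIrreducible Z ∧ (∀ x : redSub G Z hZ, IsRegularLocalRing ((redSub G Z hZ).presheaf.stalk x)) ∧
            (∀ x : redSub G Z hZ, IsRegularLocalRing (G.presheaf.stalk (redSubι G Z hZ x))) ∧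
            (∀ (i : redSub G Z hZ ⟶ redSub G E hE), i ≫ redSubι G E hE = redSubι G Z hZ →
              ∀ x : redSub G Z hZ, IsRegularLocalRing ((redSub G E hE).presheaf.stalk (i x))) ∧
            DirStepUnobs G E hE Z hZ)) ∧
        (E' = υ₂ ⁻¹' Z ∨ E' = closure (υ₂ ⁻¹' (E \ Z))) ∧
        (K' = ∅ ∨ ((ConeWitness G E hE K Z hZ ∨ closure (Z \ closure K) = Z) ∧ K' = closure (υ₂ ⁻¹' (K \ Z))))) ∨
      (Hst ∈ Es ∧ ∃ hF : IsClosed Hst, Z ⊆ Hst ∧ IsIrreducible Z ∧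
        (∀ x : redSub G Z hZ, IsRegularLocalRing ((redSub G Z hZ).presheaf.stalk x)) ∧
        (∀ x : redSub G Z hZ, IsRegularLocalRing (G.presheaf.stalk (redSubι G Z hZ x))) ∧
        (∀ (i : redSub G Z hZ ⟶ redSub G Hst hF), i ≫ redSubι G Hst hF = redSubι G Z hZ →
          ∀ x : redSub G Z hZ, IsRegularLocalRing ((redSub G Hst hF).presheaf.stalk (i x))) ∧
        DirStepUnobs G Hst hF Z hZ ∧
        E' = υ₂ ⁻¹' Z ∧
        (K' = ∅ ∨ (Disjoint Z (closure K) ∧ K' = closure (υ₂ ⁻¹' (K \ Z)))))) →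
    IsBlowup υ₂ (Scheme.IdealSheafData.vanishingIdeal (⟨Z, hZ⟩ : Closeds G)) →
    (∀ F' ∈ Es', ∃ F ∈ E :: Es, RoundTransportOKPrime υ₂ Z hZ Hst F F') →
    R G' (υ₂ ≫ γ) (closure (υ₂ ⁻¹' (T \ Z))) E' Es' K'

/-- Closure under the B′ round step implies closure under the B round step (the B step is the sub-case of tier-1 transports). [OURS · pure logic] -/
theorem towerRoundB_of_towerRoundBPrime (F₉ F₁₀ : Scheme.{0}) (υ' : F₁₀ ⟶ F₉) (Z₉ : Set F₉) (hZ₉ : IsClosed Z₉)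
    (R : ∀ G : Scheme.{0}, (G ⟶ F₁₀) → Set G → Set G → List (Set G) → Set G → Prop)
    (h : TowerRoundBPrime F₉ F₁₀ υ' Z₉ hZ₉ R) : TowerRoundB F₉ F₁₀ υ' Z₉ hZ₉ R := by
  intro G G' γ T E Es K hE Z hZ Hst υ₂ K' E' Es' hR hZT hne hfull hadm hbl hlist
  exact h G G' γ T E Es K hE Z hZ Hst υ₂ K' E' Es' hR hZT hne hfull hadm hbl
    (fun F' hF' => by
      obtain ⟨F, hF, hok⟩ := hlist F' hF'
      exact ⟨F, hF, roundTransportOKPrime_of_roundTransportOK hZ hok⟩)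

/-- **ReachTowerBPrime** — `ReachTowerB` with the round step `TowerRoundBPrime` (transversally crossed members retained); same prefix, same seed (list `[]`),
same point steps `TowerPtRegB` / `TowerPtRamB`. Downstairs only. [OURS · T23-A′ Defs] -/
def ReachTowerBPrime (F₁ F₂ : Scheme.{0}) (υ : F₂ ⟶ F₁) (x : F₁) (T₂ : Set F₂) (F' : Scheme.{0}) (β : F' ⟶ F₂) (T' : Set F') : Prop :=
  ∃ (W : Set F₁) (K₂ : Set F₂) (F₉ : Scheme.{0}) (β₉ : F₉ ⟶ F₂) (T₉ Z₉ K₉ : Set F₉) (b₉ : Bool) (hZ₉ : IsClosed Z₉)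
    (F₁₀ : Scheme.{0}) (υ' : F₁₀ ⟶ F₉) (γ' : F' ⟶ F₁₀) (E' : Set F') (Es' : List (Set F')) (K' : Set F'),
    x ∈ W ∧ ¬ (υ ⁻¹' {x} ⊆ closure (υ ⁻¹' (W \ {x}))) ∧
    (∃ U : F₁.affineOpens, x ∈ (U : F₁.Opens) ∧
      ((Scheme.IdealSheafData.vanishingIdeal (⟨closure W, isClosed_closure⟩ : Closeds F₁)).ideal U).IsPrincipal) ∧
    υ ⁻¹' {x} ∩ closure (υ ⁻¹' (W \ {x})) ⊆ T₂ ∧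
    (K₂ = ∅ ∨ (ConeForm F₁ x W ∧ K₂ = closure (υ ⁻¹' (W \ {x})))) ∧
    InCarrierReachK F₂ T₂ (υ ⁻¹' {x} ∩ closure (υ ⁻¹' (W \ {x}))) K₂ F₉ β₉ T₉ Z₉ K₉ b₉ ∧
    Z₉ ⊆ T₉ ∧ ¬ (T₉ ⊆ Z₉) ∧ Z₉.Infinite ∧
    Set.Finite {z : redSub F₉ Z₉ hZ₉ | ¬ IsRegularLocalRing ((redSub F₉ Z₉ hZ₉).presheaf.stalk z)} ∧
    IsBlowup υ' (Scheme.IdealSheafData.vanishingIdeal (⟨Z₉, hZ₉⟩ : Closeds F₉)) ∧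
    (∀ R : (∀ G : Scheme.{0}, (G ⟶ F₁₀) → Set G → Set G → List (Set G) → Set G → Prop),
      R F₁₀ (𝟙 F₁₀) (closure (υ' ⁻¹' (T₉ \ Z₉))) (υ' ⁻¹' Z₉) [] (closure (υ' ⁻¹' (K₉ \ Z₉))) →
      TowerPtRegB F₉ F₁₀ υ' R → TowerPtRamB F₉ F₁₀ υ' R → TowerRoundBPrime F₉ F₁₀ υ' Z₉ hZ₉ R → R F' γ' T' E' Es' K') ∧
    β = (γ' ≫ υ') ≫ β₉

/-- **ReachNoseTowerBPrime** — `ReachNoseTowerB` with the round step `TowerRoundBPrime` (seed list `[]`). Downstairs only. [OURS · T23-A′ Defs] -/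
def ReachNoseTowerBPrime (k : Type) [Field k] (n : ℕ) (H : Scheme.{0})
    (ι : H ⟶ (Literature.AlgebraicGeometry.Motives.projectiveSpace n k).left) : Prop :=
  ∃ (Z : Set (Literature.AlgebraicGeometry.Motives.projectiveSpace n k).left) (hZ : IsClosed Z),
    IsLiftableNoseClass₂ k n Z ∧ Z ⊆ Set.range ι ∧ ¬ (Set.range ι ⊆ Z) ∧ Z.Infinite ∧
    (∀ z : ↥(redSub (Literature.AlgebraicGeometry.Motives.projectiveSpace n k).left Z hZ),
      IsClosed ({z} : Set ↥(redSub (Literature.AlgebraicGeometry.Motives.projectiveSpace n k).left Z hZ)) →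
        ringKrullDim ((redSub (Literature.AlgebraicGeometry.Motives.projectiveSpace n k).left Z hZ).presheaf.stalk z) =
          ((1 : ℕ) : WithBot ℕ∞)) ∧
    ∃ (F₂ : Scheme.{0}) (υ : F₂ ⟶ (Literature.AlgebraicGeometry.Motives.projectiveSpace n k).left),
      IsBlowup υ (Scheme.IdealSheafData.vanishingIdeal
        (⟨Z, hZ⟩ : Closeds (Literature.AlgebraicGeometry.Motives.projectiveSpace n k).left)) ∧
      ∃ (F' : Scheme.{0}) (γ' : F' ⟶ F₂) (T' E' : Set F') (Es' : List (Set F')) (K' : Set F'),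
        (∀ R : (∀ G : Scheme.{0}, (G ⟶ F₂) → Set G → Set G → List (Set G) → Set G → Prop),
          R F₂ (𝟙 F₂) (closure (υ ⁻¹' (Set.range ι \ Z))) (υ ⁻¹' Z) [] ∅ →
          TowerPtRegB (Literature.AlgebraicGeometry.Motives.projectiveSpace n k).left F₂ υ R →
          TowerPtRamB (Literature.AlgebraicGeometry.Motives.projectiveSpace n k).left F₂ υ R →
          TowerRoundBPrime (Literature.AlgebraicGeometry.Motives.projectiveSpace n k).left F₂ υ Z hZ R →
          R F' γ' T' E' Es' K') ∧
        Literature.AlgebraicGeometry.Resolution.Scheme.IsRegular (redSub F' (closure T') isClosed_closure)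

/-- **TOWER-B ⊆ TOWER-B′**: a B-chain is a B′-chain. [OURS · pure logic] -/
theorem reachTowerBPrime_of_reachTowerB (F₁ F₂ : Scheme.{0}) (υ : F₂ ⟶ F₁) (x : F₁) (T₂ : Set F₂) (F' : Scheme.{0}) (β : F' ⟶ F₂)
    (T' : Set F') (h : ReachTowerB F₁ F₂ υ x T₂ F' β T') : ReachTowerBPrime F₁ F₂ υ x T₂ F' β T' := by
  obtain ⟨W, K₂, F₉, β₉, T₉, Z₉, K₉, b₉, hZ₉, F₁₀, υ', γ', E', Es', K', h1, h2, h3, h4, h5, h6, h7, h8, h9, h10, h11, hcl, hβ⟩ := h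
  refine ⟨W, K₂, F₉, β₉, T₉, Z₉, K₉, b₉, hZ₉, F₁₀, υ', γ', E', Es', K', h1, h2, h3, h4, h5, h6, h7, h8, h9, h10, h11, ?_, hβ⟩
  intro R hseed hreg hram hround
  exact hcl R hseed hreg hram (towerRoundB_of_towerRoundBPrime F₉ F₁₀ υ' Z₉ hZ₉ R hround)

/-- **NOSE-B ⊆ NOSE-B′**. [OURS · pure logic] -/
theorem reachNoseTowerBPrime_of_reachNoseTowerB (k : Type) [Field k] (n : ℕ) (H : Scheme.{0})
    (ι : H ⟶ (Literature.AlgebraicGeometry.Motives.projectiveSpace n k).left) (h : ReachNoseTowerB k n H ι) :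
    ReachNoseTowerBPrime k n H ι := by
  obtain ⟨Z, hZ, h1, h2, h3, h4, h5, F₂, υ, hυ, F', γ', T', E', Es', K', hcl, hreg⟩ := h
  refine ⟨Z, hZ, h1, h2, h3, h4, h5, F₂, υ, hυ, F', γ', T', E', Es', K', ?_, hreg⟩
  intro R hseed hreg' hram hround
  exact hcl R hseed hreg' hram (towerRoundB_of_towerRoundBPrime _ F₂ υ Z hZ R hround)

end Summit.ResolutionOfSingularities.ResolutionOfSingularities.Cruxes.EquisingularLiftNat.Sections

end
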